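import Summits.CriticalPhenomena.PercolationContinuityZ3.Theorems.Transplant.SkelPhiApronKitDefs
import HarnessLib

/-!
# N1 (the `{±1}` node), LEVEL 1, kit adapter file N-K4d: **THE APRON KIT GEOMETRY SATISFIES `KitOK`** — apron vertices in the window, ABSORPTION of far
# contacts whose inner neighbour is wired by a near kit (`apronGeomA`), and `Skelφ.kitOK_apronA` (the N1 replacement of D″'s `kitOK_slabDeep`)

builds on p205010 (kernel theorem, internal audit signed; external expert review pending) — nothing in this file uses p205010; nothing here is a
claim about the open node `SamePDropOfSkeletonNeg`.  Lane `prim-bschramm`, seat `prim-bschramm-p1` (gen 11; design KIT-APRON-N1); helper file.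
Hypotheses (integer inequalities left to the consumer): `Lip G ψ`, `QStepsN G ψ N`, `Steps G φ`, a degree bound; the side forms `SF i σ` of the box
`Icc (lo − j) (hi + j)` with placement inequalities `hbelow/habove/hK/hKC`; `Compat`-type control `hcomp`; a short-region map `Rg` in graph balls of
radius `Rs` with `≤ cU` vertices; box widths; the constants `rs, r₀, cS`.
* §1 `exit_mem_of_sdepth`, `apron_sdepth` (`1 ≤ sdepth < D`), `apron_sub_mem_box`, `mem_Icc_of_mem_ctApron`, `ctApron_subset_graphBall`;
* §2 `ctReg`, `IsNear`, `hosts`/`host`, **`apronGeomA`**; §3 **`kitOK_apronA`**.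
[cite: KozmaNitzan2024, §4 Lemma 10, p. 19 (Step III), p. 21 (v(P) + Λ_M, U(P))] [cite: GrimmettPercolation1999, §7.2]
-/

noncomputable section

open scoped Classical

namespace Summit.CriticalPhenomena.PercolationContinuityZ3.Theorems.Transplant

namespace Skelφ

open Literature.Probability.Percolation Literature.Probability.LatticeModels SimpleGraph KNLevels
open Literature.Probability.Percolation.KozmaNitzan.Cells (oth oth_ne eq_oth_of_ne oth_oth)
open Literature.Barriers.CriticalPhenomena (graphBall graphBall_finite mem_graphBall_self graphBall_mono)
open Skel (winGraph winGraph_adj KitGeom)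
open SkelI (slabPt tanOff tanTgt tanTgt_mem natAbs_tanTgt_sub_le)

variable {V : Type} [DecidableEq V] {G : SimpleGraph V} [G.LocallyFinite] {ψ φ : V → Site 2}

/-! ## §1 Apron vertices: depth, exit coordinate, tangential coordinate, radius -/

section Apron

variable {w₀ : V} {R : ℕ} {Lo Hi : Site 2} (SF : ∀ (i : Fin 2) (σ : ℤˣ), SideForm ψ φ Lo Hi i σ) {P : ApronPrm} {Kmax : ℕ}

omit [DecidableEq V] [G.LocallyFinite] in
/-- The exit coordinate from the depth bounds `1 ≤ sdepth < D` (`Lo i₀ + D ≤ Hi i₀`). [folklore] -/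
theorem exit_mem_of_sdepth {i₀ : Fin 2} {σ₀ : ℤˣ} {v : V} {D : ℕ} (h1 : 1 ≤ sdepth ψ Lo Hi i₀ σ₀ v) (h2 : sdepth ψ Lo Hi i₀ σ₀ v < D)
    (hD : Lo i₀ + D ≤ Hi i₀) : Lo i₀ + 1 ≤ ψ v i₀ ∧ ψ v i₀ ≤ Hi i₀ - 1 := by
  unfold sdepth at h1 h2
  split_ifs at h1 h2 <;> constructor <;> omega

/-- **Apron vertices sit strictly between the boundary layer and the shell line**: `1 ≤ sdepth < D` (near contact `x`; placement hypotheses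
`hbelow`, `habove`). [this work] -/
theorem apron_sdepth (hlip : Lip G ψ) (hq : QStepsN G ψ P.N) (hstep : Steps G φ) (hw2 : ∀ i, Lo i + 2 ≤ Hi i)
    (hbelow : ∀ (i : Fin 2) (σ : ℤˣ) (z : Site 2), (SF i σ).lin z < (SF i σ).θ (2 + P.d) → ∀ m : ℤ, -(P.W : ℤ) ≤ m → m ≤ P.W →
      (SF i σ).lin (apronPt z (SF i σ).a (SF i σ).s m 0) + P.ℓ * (SF i σ).UL < (SF i σ).θ (shellD P))
    (habove : ∀ (i : Fin 2) (σ : ℤˣ) (z : Site 2), (SF i σ).θ (1 + P.d) ≤ (SF i σ).lin z → ∀ m : ℤ, -(P.W : ℤ) ≤ m → m ≤ P.W →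
      (SF i σ).θ 1 ≤ (SF i σ).lin (apronPt z (SF i σ).a (SF i σ).s m 0) - P.ℓ * (SF i σ).UL)
    {x : V} (hx : x ∈ outerBoundary (winGraph G w₀ R) (Win G ψ w₀ (Finset.Icc Lo Hi) R)) {v : V} (hv : v ∈ ctApron G SF P w₀ R x) :
    1 ≤ sdepth ψ Lo Hi (ctDir G ψ w₀ R Lo Hi x).1 (ctDir G ψ w₀ R Lo Hi x).2 v ∧
      sdepth ψ Lo Hi (ctDir G ψ w₀ R Lo Hi x).1 (ctDir G ψ w₀ R Lo Hi x).2 v < shellD P := by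
  have ht := (ψ_ctT1 hlip hq hw2 hx).1
  set F := SF (ctDir G ψ w₀ R Lo Hi x).1 (ctDir G ψ w₀ R Lo Hi x).2 with hF
  have hzlt : F.lin (φ (ctT1 G ψ P w₀ R Lo Hi x)) < F.θ (2 + P.d) := F.lin_lt_of_sdepth_lt (by rw [ht]; omega)
  have hzge : F.θ (1 + P.d) ≤ F.lin (φ (ctT1 G ψ P w₀ R Lo Hi x)) := F.le_lin_of_le_sdepth (by rw [ht])
  unfold ctApron at hv
  obtain ⟨m, hm1, hm2, k, hk, hbox, -⟩ := exists_of_mem_apronFin hstep hv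
  exact ⟨F.le_sdepth_of_apron (habove _ _ _ hzge m hm1 hm2) k hbox, F.sdepth_lt_of_apron (hbelow _ _ _ hzlt m hm1 hm2) hk hbox⟩

omit [DecidableEq V] in
/-- **Apron vertices are `φ`-within `W + Kmax + ℓ` of the stem end** (bounded height profile `hK`). [folklore] -/
theorem apron_sub_mem_box (hstep : Steps G φ) {t : V} {a : Fin 2} {s : ℤˣ} {K : ℤ → ℕ}
    (hK : ∀ m : ℤ, -(P.W : ℤ) ≤ m → m ≤ P.W → K m ≤ Kmax) {v : V} (hv : v ∈ apronFin G φ t a s P.W K P.ℓ P.R') :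
    φ v - φ t ∈ box 2 (P.W + Kmax + P.ℓ) := by
  obtain ⟨m, hm1, hm2, k, hk, hbox, -⟩ := exists_of_mem_apronFin hstep hv
  have hKm := hK m hm1 hm2
  rw [mem_box] at hbox ⊢
  intro i
  have hb := hbox i
  have hs1 : (s : ℤ) = 1 ∨ (s : ℤ) = -1 := by rcases Int.units_eq_one_or s with h | h <;> simp [h]
  have hk' : (k : ℤ) ≤ Kmax := by exact_mod_cast hk.trans hKm
  have e : (φ v - φ t) i = (φ v - apronPt (φ t) a s m k) i + (apronPt (φ t) a s m k - φ t) i := by simp only [Pi.sub_apply]; ring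
  rw [e]
  by_cases hi : i = a
  · subst hi
    have : (apronPt (φ t) i s m k - φ t) i = (k : ℤ) * (s : ℤ) := by
      simp [apronPt, Pi.single_eq_of_ne (oth_ne i).symm]
    rw [this]; push_cast
    rcases hs1 with h1 | h1 <;> rw [h1] <;> constructor <;> nlinarith [hb.1, hb.2]
  · rw [eq_oth_of_ne hi] at hb ⊢
    have : (apronPt (φ t) a s m k - φ t) (oth a) = m := by
      simp [apronPt, Pi.single_eq_of_ne (oth_ne a)]
    rw [this]; push_cast; constructor <;> linarith [hb.1, hb.2]

/-- **The apron of a near contact lies in the level box** (placement hypotheses, bounded profile, `Compat`-type control `hcomp`, tangential clamp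
`T₀ ≥ W + Kmax + ℓ + 1`, exit width `≥ D`). [this work] -/
theorem mem_Icc_of_mem_ctApron (hlip : Lip G ψ) (hq : QStepsN G ψ P.N) (hstep : Steps G φ) (hwide : ∀ i, Lo i + 2 * tanOff P.ℓs P.M ≤ Hi i)
    (hbelow : ∀ (i : Fin 2) (σ : ℤˣ) (z : Site 2), (SF i σ).lin z < (SF i σ).θ (2 + P.d) → ∀ m : ℤ, -(P.W : ℤ) ≤ m → m ≤ P.W →
      (SF i σ).lin (apronPt z (SF i σ).a (SF i σ).s m 0) + P.ℓ * (SF i σ).UL < (SF i σ).θ (shellD P))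
    (habove : ∀ (i : Fin 2) (σ : ℤˣ) (z : Site 2), (SF i σ).θ (1 + P.d) ≤ (SF i σ).lin z → ∀ m : ℤ, -(P.W : ℤ) ≤ m → m ≤ P.W →
      (SF i σ).θ 1 ≤ (SF i σ).lin (apronPt z (SF i σ).a (SF i σ).s m 0) - P.ℓ * (SF i σ).UL)
    (hK : ∀ (i : Fin 2) (σ : ℤˣ) (z : Site 2), (SF i σ).θ (1 + P.d) ≤ (SF i σ).lin z → ∀ m : ℤ, -(P.W : ℤ) ≤ m → m ≤ P.W →
      (SF i σ).apronK z (shellD P) P.ℓ m ≤ Kmax)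
    (hcomp : ∀ (v w : V) (n : ℕ), φ v - φ w ∈ box 2 n → ∀ i, |ψ v i - ψ w i| ≤ n + 1)
    (hT : (P.W : ℤ) + Kmax + P.ℓ + 1 ≤ tanOff P.ℓs P.M)
    {x : V} (hx : x ∈ outerBoundary (winGraph G w₀ R) (Win G ψ w₀ (Finset.Icc Lo Hi) R)) {v : V} (hv : v ∈ ctApron G SF P w₀ R x) :
    ψ v ∈ Finset.Icc Lo Hi := by
  have hw2 : ∀ i, Lo i + 2 ≤ Hi i := fun i => by have := hwide i; unfold tanOff at this; omega
  have hD : ∀ i, Lo i + shellD P ≤ Hi i := fun i => by have := hwide i; unfold tanOff at this; unfold shellD; push_cast; omega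
  obtain ⟨h1, h2⟩ := apron_sdepth SF hlip hq hstep hw2 hbelow habove hx hv
  have hexit := exit_mem_of_sdepth h1 h2 (hD _)
  -- tangential coordinate
  have ht := ψ_ctT1 hlip hq hw2 hx
  set F := SF (ctDir G ψ w₀ R Lo Hi x).1 (ctDir G ψ w₀ R Lo Hi x).2 with hF
  have hzge : F.θ (1 + P.d) ≤ F.lin (φ (ctT1 G ψ P w₀ R Lo Hi x)) := F.le_lin_of_le_sdepth (by rw [ht.1])
  have hvbox : φ v - φ (ctT1 G ψ P w₀ R Lo Hi x) ∈ box 2 (P.W + Kmax + P.ℓ) := by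
    unfold ctApron at hv
    exact apron_sub_mem_box (P := P) hstep (hK _ _ _ hzge) hv
  have htan := hcomp v (ctT1 G ψ P w₀ R Lo Hi x) _ hvbox (oth (ctDir G ψ w₀ R Lo Hi x).1)
  rw [ht.2, abs_le] at htan
  have hτ := tanTgt_mem (oth (ctDir G ψ w₀ R Lo Hi x).1) (hwide _) (ψ (ctY G ψ w₀ R Lo Hi x))
  push_cast at htan
  rw [Finset.mem_Icc]
  constructor <;> intro i
  · by_cases hi : i = (ctDir G ψ w₀ R Lo Hi x).1
    · rw [hi]; linarith [hexit.1]
    · rw [eq_oth_of_ne hi]; linarith [htan.1, hτ.1]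
  · by_cases hi : i = (ctDir G ψ w₀ R Lo Hi x).1
    · rw [hi]; linarith [hexit.2]
    · rw [eq_oth_of_ne hi]; linarith [htan.2, hτ.2]

/-- The apron of a contact is within graph distance `1 + N(T₀+1) + N d + W + Kmax + R′` of the contact. [folklore] -/
theorem ctApron_subset_graphBall (hlip : Lip G ψ) (hq : QStepsN G ψ P.N) (hstep : Steps G φ) (hwide : ∀ i, Lo i + 2 * tanOff P.ℓs P.M ≤ Hi i)
    (hK : ∀ (i : Fin 2) (σ : ℤˣ) (z : Site 2), (SF i σ).θ (1 + P.d) ≤ (SF i σ).lin z → ∀ m : ℤ, -(P.W : ℤ) ≤ m → m ≤ P.W →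
      (SF i σ).apronK z (shellD P) P.ℓ m ≤ Kmax)
    {x : V} (hx : x ∈ outerBoundary (winGraph G w₀ R) (Win G ψ w₀ (Finset.Icc Lo Hi) R)) :
    ∀ v ∈ ctApron G SF P w₀ R x, v ∈ graphBall G (ctY G ψ w₀ R Lo Hi x) (P.N * (tanOff P.ℓs P.M + 1) + P.N * P.d + (P.W + Kmax + P.R')) := by
  intro v hv
  have hw2 : ∀ i, Lo i + 2 ≤ Hi i := fun i => by have := hwide i; unfold tanOff at this; omega
  have ht := ψ_ctT1 hlip hq hw2 hx
  have hzge : (SF (ctDir G ψ w₀ R Lo Hi x).1 (ctDir G ψ w₀ R Lo Hi x).2).θ (1 + P.d) ≤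
      (SF (ctDir G ψ w₀ R Lo Hi x).1 (ctDir G ψ w₀ R Lo Hi x).2).lin (φ (ctT1 G ψ P w₀ R Lo Hi x)) :=
    (SF _ _).le_lin_of_le_sdepth (by rw [ht.1])
  unfold ctApron at hv
  have h1 := apronFin_subset_graphBall hstep (t := ctT1 G ψ P w₀ R Lo Hi x) (hK _ _ _ hzge) v hv
  exact BoxProdZ2.mem_graphBall_add G (ctT1_mem_graphBall hq hwide hx) h1

end Apron

/-! ## §2 Absorption of far contacts wired by a near kit; the geometry `apronGeomA` -/

section Geom
variable (G) {Lo Hi : Site 2} (SF : ∀ (i : Fin 2) (σ : ℤˣ), SideForm ψ φ Lo Hi i σ) (Rg : V → Finset V) (P : ApronPrm) (w₀ : V) (R : ℕ)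

/-- **The wired region of a near contact**: wired `ψ`-path ∪ apron. [this work] -/
def ctReg (x : V) : Finset V := ctWire G ψ P w₀ R Lo Hi x ∪ ctApron G SF P w₀ R x

variable (ψ) (Lo Hi) in
/-- A contact is NEAR when its inner neighbour lies in `B_G(w₀, R − r₀)`. [folklore] -/
def IsNear (x : V) : Prop := ctY G ψ w₀ R Lo Hi x ∈ graphBall G w₀ (R - P.r₀)

/-- **The hosts of a contact**: the near contacts of `K` whose wired region contains its inner neighbour. [this work] -/
def hosts (K : Finset V) (x : V) : Finset V :=
  K.filter fun x₀ => IsNear G ψ Lo Hi P w₀ R x₀ ∧ ctY G ψ w₀ R Lo Hi x ∈ ctReg G SF P w₀ R x₀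

/-- A chosen host (the contact itself if there is none). [this work] -/
def host (K : Finset V) (x : V) : V :=
  if h : (hosts G SF P w₀ R K x).Nonempty then h.choose else x

/-- **The apron kit geometry with absorption** over the contact set `K`: a NEAR contact gets its own wired region and face; a far contact whose inner
neighbour is wired by some near contact of `K` is ABSORBED (it gets that contact's region and face); every other far contact gets `{y}` (edge-contact
remedy).  Absorption is what keeps the far inner neighbours of the pinning set off the near kits' wired regions under quasi-steps. [this work] -/
def apronGeomA (K : Finset V) : KitGeom V where
  y := ctY G ψ w₀ R Lo Hi
  S := fun x => if IsNear G ψ Lo Hi P w₀ R x then ctReg G SF P w₀ R x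
    else if (hosts G SF P w₀ R K x).Nonempty then ctReg G SF P w₀ R (host G SF P w₀ R K x) else {ctY G ψ w₀ R Lo Hi x}
  U := fun x => if IsNear G ψ Lo Hi P w₀ R x then ctFace G SF Rg P w₀ R x
    else if (hosts G SF P w₀ R K x).Nonempty then ctFace G SF Rg P w₀ R (host G SF P w₀ R K x) else {ctY G ψ w₀ R Lo Hi x}

variable {G SF Rg P w₀ R}

/-- A chosen host is a host. [folklore] -/
theorem host_mem {K : Finset V} {x : V} (h : (hosts G SF P w₀ R K x).Nonempty) : host G SF P w₀ R K x ∈ hosts G SF P w₀ R K x := by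
  unfold host; rw [dif_pos h]; exact h.choose_spec

/-- Unfolding of `hosts`. [folklore] -/
theorem mem_hosts {K : Finset V} {x x₀ : V} :
    x₀ ∈ hosts G SF P w₀ R K x ↔ x₀ ∈ K ∧ IsNear G ψ Lo Hi P w₀ R x₀ ∧ ctY G ψ w₀ R Lo Hi x ∈ ctReg G SF P w₀ R x₀ := by
  unfold hosts; rw [Finset.mem_filter]

end Geom
/-! ## §3 The apron kit geometry satisfies `KitOK` -/

section OK

variable {w₀ : V} {R : ℕ}
/-- **THE APRON KIT GEOMETRY (WITH ABSORPTION) SATISFIES `KitOK`** (the N1 replacement of `kitOK_slabDeep`).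
[cite: KozmaNitzan2024, §4 Lemma 10, p. 19 (Step III)] -/
theorem kitOK_apronA {lo hi : Site 2} {j : ℕ} (SF : ∀ (i : Fin 2) (σ : ℤˣ), SideForm ψ φ (lo - (j : Site 2)) (hi + (j : Site 2)) i σ)
    (Rg : V → Finset V) {P : ApronPrm} {Kmax KCmax Rs rs cS cU Δ : ℕ}
    (hlip : Lip G ψ) (hq : QStepsN G ψ P.N) (hstep : Steps G φ) (hΔ : ∀ v, G.degree v ≤ Δ)
    (hwide : ∀ i, (lo - (j : Site 2)) i + 2 * tanOff P.ℓs P.M ≤ (hi + (j : Site 2)) i)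
    (hdw : ∀ i, (lo - (j : Site 2)) i + (P.d + 2 : ℕ) ≤ (hi + (j : Site 2)) i)
    (hbelow : ∀ (i : Fin 2) (σ : ℤˣ) (z : Site 2), (SF i σ).lin z < (SF i σ).θ (2 + P.d) → ∀ m : ℤ, -(P.W : ℤ) ≤ m → m ≤ P.W →
      (SF i σ).lin (apronPt z (SF i σ).a (SF i σ).s m 0) + P.ℓ * (SF i σ).UL < (SF i σ).θ (shellD P))
    (habove : ∀ (i : Fin 2) (σ : ℤˣ) (z : Site 2), (SF i σ).θ (1 + P.d) ≤ (SF i σ).lin z → ∀ m : ℤ, -(P.W : ℤ) ≤ m → m ≤ P.W →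
      (SF i σ).θ 1 ≤ (SF i σ).lin (apronPt z (SF i σ).a (SF i σ).s m 0) - P.ℓ * (SF i σ).UL)
    (hK : ∀ (i : Fin 2) (σ : ℤˣ) (z : Site 2), (SF i σ).θ (1 + P.d) ≤ (SF i σ).lin z → ∀ m : ℤ, -(P.W : ℤ) ≤ m → m ≤ P.W →
      (SF i σ).apronK z (shellD P) P.ℓ m ≤ Kmax)
    (hKC : ∀ (i : Fin 2) (σ : ℤˣ) (z : Site 2), (SF i σ).θ (1 + P.d) ≤ (SF i σ).lin z → (SF i σ).lin z < (SF i σ).θ (2 + P.d) →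
      (SF i σ).kitK z (shellD P) P.A ≤ KCmax)
    (hcomp : ∀ (v w : V) (n : ℕ), φ v - φ w ∈ box 2 n → ∀ i, |ψ v i - ψ w i| ≤ n + 1)
    (hT : (P.W : ℤ) + Kmax + P.ℓ + 1 ≤ tanOff P.ℓs P.M)
    (hRg : ∀ c, ∀ u ∈ Rg c, u ∈ graphBall G c Rs) (hRgcard : ∀ c, (Rg c).card ≤ cU) (hcU1 : 1 ≤ cU)
    (hr₀ : P.N * (tanOff P.ℓs P.M + 2) + P.N * P.d + (P.W + Kmax + P.R') ≤ P.r₀) (hR : P.r₀ ≤ R)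
    (hrs : 2 * (1 + P.N * (tanOff P.ℓs P.M + 2) + P.N * P.d + (P.W + Kmax + P.R') + (KCmax + Rs)) ≤ rs)
    (hcS : (P.N + 1) * (tanOff P.ℓs P.M + 1) + (P.N + 1) * P.d + (2 * P.W + 1) * (Kmax + 1) * (Δ + 1) ^ P.R' ≤ cS) :
    KitOK G ψ w₀ R lo hi j rs cS cU
      (apronGeomA G SF Rg P w₀ R (outerBoundary (winGraph G w₀ R) (winLevel G ψ w₀ R lo hi j))) := by
  have hKeq : winLevel G ψ w₀ R lo hi j = Win G ψ w₀ (Finset.Icc (lo - (j : Site 2)) (hi + (j : Site 2))) R := rfl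
  have hx' : ∀ x ∈ (outerBoundary (winGraph G w₀ R) (winLevel G ψ w₀ R lo hi j)), x ∈ outerBoundary (winGraph G w₀ R) (Win G ψ w₀ (Finset.Icc (lo - (j : Site 2)) (hi + (j : Site 2))) R) := fun x hx => by rwa [hKeq] at hx
  have hw2 : ∀ i, (lo - (j : Site 2)) i + 2 ≤ (hi + (j : Site 2)) i := fun i => by have := hwide i; unfold tanOff at this; omega
  have h1cS : 1 ≤ cS := by
    have h1 : 1 ≤ (P.N + 1) * (tanOff P.ℓs P.M + 1) := Nat.succ_le_of_lt (Nat.mul_pos (by omega) (by omega))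
    omega
  have hy : ∀ x ∈ (outerBoundary (winGraph G w₀ R) (winLevel G ψ w₀ R lo hi j)), G.Adj x (ctY G ψ w₀ R (lo - (j : Site 2)) (hi + (j : Site 2)) x) ∧ ctY G ψ w₀ R (lo - (j : Site 2)) (hi + (j : Site 2)) x ∈ graphBall G w₀ R ∧ ψ (ctY G ψ w₀ R (lo - (j : Site 2)) (hi + (j : Site 2)) x) ∈ Finset.Icc (lo - (j : Site 2)) (hi + (j : Site 2)) :=
    fun x hx => inNbr_spec (hx' x hx)
  have hyW : ∀ x ∈ (outerBoundary (winGraph G w₀ R) (winLevel G ψ w₀ R lo hi j)), ctY G ψ w₀ R (lo - (j : Site 2)) (hi + (j : Site 2)) x ∈ winLevel G ψ w₀ R lo hi j := fun x hx => by rw [hKeq, mem_Win]; exact ⟨(hy x hx).2.1, (hy x hx).2.2⟩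
  have hy1 : ∀ x ∈ (outerBoundary (winGraph G w₀ R) (winLevel G ψ w₀ R lo hi j)), ctY G ψ w₀ R (lo - (j : Site 2)) (hi + (j : Site 2)) x ∈ graphBall G x 1 := fun x hx =>
    BoxProdZ2.mem_graphBall_succ_of_adj G (mem_graphBall_self G x 0) (hy x hx).1
  -- THE NEAR KIT of a contact `x ∈ (outerBoundary (winGraph G w₀ R) (winLevel G ψ w₀ R lo hi j))` seen from its inner neighbour `y`, radius `r₁`
  set r₁ : ℕ := P.N * (tanOff P.ℓs P.M + 2) + P.N * P.d + (P.W + Kmax + P.R') + (KCmax + Rs) with hr₁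
  have hNle : P.N * (tanOff P.ℓs P.M + 1) ≤ P.N * (tanOff P.ℓs P.M + 2) := Nat.mul_le_mul_left P.N (by omega)
  have hregB : ∀ x ∈ (outerBoundary (winGraph G w₀ R) (winLevel G ψ w₀ R lo hi j)), ∀ v ∈ ctReg G SF P w₀ R x, v ∈ graphBall G (ctY G ψ w₀ R (lo - (j : Site 2)) (hi + (j : Site 2)) x) r₁ := by
    intro x hx v hv
    unfold ctReg at hv
    rcases Finset.mem_union.1 hv with h | h
    · exact graphBall_mono G _ (by omega) (ctWire_subset_graphBall' hq hwide (hx' x hx) v h)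
    · exact graphBall_mono G _ (by omega) (ctApron_subset_graphBall SF hlip hq hstep hwide hK (hx' x hx) v h)
  have hregB₀ : ∀ x ∈ (outerBoundary (winGraph G w₀ R) (winLevel G ψ w₀ R lo hi j)), ∀ v ∈ ctReg G SF P w₀ R x, v ∈ graphBall G (ctY G ψ w₀ R (lo - (j : Site 2)) (hi + (j : Site 2)) x) P.r₀ := by
    intro x hx v hv
    unfold ctReg at hv
    rcases Finset.mem_union.1 hv with h | h
    · exact graphBall_mono G _ (by omega) (ctWire_subset_graphBall' hq hwide (hx' x hx) v h)
    · exact graphBall_mono G _ (by omega) (ctApron_subset_graphBall SF hlip hq hstep hwide hK (hx' x hx) v h)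
  have hctrB : ∀ x ∈ (outerBoundary (winGraph G w₀ R) (winLevel G ψ w₀ R lo hi j)), ctCtr G SF P w₀ R x ∈ graphBall G (ctY G ψ w₀ R (lo - (j : Site 2)) (hi + (j : Site 2)) x) (P.N * (tanOff P.ℓs P.M + 1) + P.N * P.d + KCmax) := by
    intro x hx
    have ht := ψ_ctT1 hlip hq hw2 (hx' x hx)
    have hzge := (SF (ctDir G ψ w₀ R (lo - (j : Site 2)) (hi + (j : Site 2)) x).1 (ctDir G ψ w₀ R (lo - (j : Site 2)) (hi + (j : Site 2)) x).2).le_lin_of_le_sdepth (φ := φ) (v := ctT1 G ψ P w₀ R (lo - (j : Site 2)) (hi + (j : Site 2)) x)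
      (m := 1 + P.d) (by rw [ht.1])
    have hzlt := (SF (ctDir G ψ w₀ R (lo - (j : Site 2)) (hi + (j : Site 2)) x).1 (ctDir G ψ w₀ R (lo - (j : Site 2)) (hi + (j : Site 2)) x).2).lin_lt_of_sdepth_lt (φ := φ) (v := ctT1 G ψ P w₀ R (lo - (j : Site 2)) (hi + (j : Site 2)) x)
      (m := 2 + P.d) (by rw [ht.1]; omega)
    have h := ctCtr_mem_graphBall SF (P := P) (w₀ := w₀) (R := R) hstep x
    exact BoxProdZ2.mem_graphBall_add G (ctT1_mem_graphBall hq hwide (hx' x hx)) (graphBall_mono G _ (hKC _ _ _ hzge hzlt) h)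
  have hfaceB : ∀ x ∈ (outerBoundary (winGraph G w₀ R) (winLevel G ψ w₀ R lo hi j)), ∀ u ∈ ctFace G SF Rg P w₀ R x, u ∈ graphBall G (ctY G ψ w₀ R (lo - (j : Site 2)) (hi + (j : Site 2)) x) r₁ := by
    intro x hx u hu
    have h1 := ctQk_subset_Rg SF Rg (P := P) x (ctFace_subset_ctQk SF Rg x hu)
    have h3 := BoxProdZ2.mem_graphBall_add G (hctrB x hx) (hRg _ u h1)
    exact graphBall_mono G _ (by omega) h3
  have hregW : ∀ x ∈ (outerBoundary (winGraph G w₀ R) (winLevel G ψ w₀ R lo hi j)), IsNear G ψ (lo - (j : Site 2)) (hi + (j : Site 2)) P w₀ R x → ctReg G SF P w₀ R x ⊆ winLevel G ψ w₀ R lo hi j := by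
    intro x hx hnear v hv
    have hball : v ∈ graphBall G w₀ R := by
      have h := BoxProdZ2.mem_graphBall_add G hnear (hregB₀ x hx v hv)
      rwa [Nat.sub_add_cancel hR] at h
    rw [hKeq, mem_Win]
    refine ⟨hball, ?_⟩
    unfold ctReg at hv
    rcases Finset.mem_union.1 hv with h | h
    · exact mem_Icc_of_mem_ctWire hlip hq hwide hdw (hx' x hx) h
    · exact mem_Icc_of_mem_ctApron SF hlip hq hstep hwide hbelow habove hK hcomp hT (hx' x hx) h
  have hfaceW : ∀ x ∈ (outerBoundary (winGraph G w₀ R) (winLevel G ψ w₀ R lo hi j)), ctFace G SF Rg P w₀ R x ⊆ winLevel G ψ w₀ R lo hi j := by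
    intro x hx u hu
    have h := ctQk_subset_shellWinA SF Rg (P := P) x (ctFace_subset_ctQk SF Rg x hu)
    unfold shellWinA at h
    rw [mem_Win] at h
    rw [hKeq, mem_Win]
    refine ⟨h.1, ?_⟩
    have h2 := h.2
    rw [Finset.mem_Icc] at h2 ⊢
    constructor <;> intro i
    · have := h2.1 i; simp only [Pi.add_apply, Pi.natCast_apply] at this; push_cast at this; linarith
    · have := h2.2 i; simp only [Pi.sub_apply, Pi.natCast_apply] at this; push_cast at this; linarith
  have hyreg : ∀ x ∈ (outerBoundary (winGraph G w₀ R) (winLevel G ψ w₀ R lo hi j)), ctY G ψ w₀ R (lo - (j : Site 2)) (hi + (j : Site 2)) x ∈ ctReg G SF P w₀ R x := fun x hx => by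
    unfold ctReg ctWire; exact Finset.mem_union_left _ (left_mem_wireFinQ _ _ _ _ _ _ _ _ _)
  have hregP : ∀ x ∈ (outerBoundary (winGraph G w₀ R) (winLevel G ψ w₀ R lo hi j)), ∀ v ∈ ctReg G SF P w₀ R x, PathIn G (↑(ctReg G SF P w₀ R x) : Set V) (ctY G ψ w₀ R (lo - (j : Site 2)) (hi + (j : Site 2)) x) v := by
    intro x hx v hv
    have hAw : ∀ u ∈ ctWire G ψ P w₀ R (lo - (j : Site 2)) (hi + (j : Site 2)) x, u ∈ (↑(ctReg G SF P w₀ R x) : Set V) := fun u hu => by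
      rw [Finset.mem_coe]; unfold ctReg; exact Finset.mem_union_left _ hu
    have hAa : (↑(ctApron G SF P w₀ R x) : Set V) ⊆ ↑(ctReg G SF P w₀ R x) := fun u hu => by
      rw [Finset.mem_coe] at hu ⊢; unfold ctReg; exact Finset.mem_union_right _ hu
    have hwire : ∀ u ∈ ctWire G ψ P w₀ R (lo - (j : Site 2)) (hi + (j : Site 2)) x, PathIn G (↑(ctReg G SF P w₀ R x) : Set V) (ctY G ψ w₀ R (lo - (j : Site 2)) (hi + (j : Site 2)) x) u := fun u hu => by
      unfold ctWire at hu hAw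
      exact pathIn_of_wireFinQ_subset hq _ (hw2 _) _ (hy x hx).2.2 hAw u hu
    unfold ctReg at hv
    rcases Finset.mem_union.1 hv with h | h
    · exact hwire v h
    · have ht1 : ctT1 G ψ P w₀ R (lo - (j : Site 2)) (hi + (j : Site 2)) x ∈ ctWire G ψ P w₀ R (lo - (j : Site 2)) (hi + (j : Site 2)) x := by
        unfold ctT1 ctWire; exact stemEnd_mem_wireFinQ hq _ (hw2 _) _ (hy x hx).2.2 P.d
      refine (hwire _ ht1).trans ?_
      unfold ctApron at h hAa
      exact (pathIn_apronFin hstep _ _ _ _ _ _ _ v h).mono hAa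
  have hregC : ∀ x ∈ (outerBoundary (winGraph G w₀ R) (winLevel G ψ w₀ R lo hi j)), (ctReg G SF P w₀ R x).card ≤ cS := by
    intro x hx
    unfold ctReg
    refine (Finset.card_union_le _ _).trans (le_trans (Nat.add_le_add ?_ ?_) hcS)
    · unfold ctWire
      refine (card_wireFinQ_le _ _ _ _ _ _ _ _ _).trans ?_
      have hK' := pathLen_le (φ := ψ) (ℓs := P.ℓs) (M := P.M) (ctDir G ψ w₀ R (lo - (j : Site 2)) (hi + (j : Site 2)) x).1 (hwide (oth _)) (hy x hx).2.2
      exact Nat.add_le_add_right (Nat.mul_le_mul_left _ (by unfold ctY at hK' ⊢; omega)) _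
    · have ht := ψ_ctT1 hlip hq hw2 (hx' x hx)
      have hzge := (SF (ctDir G ψ w₀ R (lo - (j : Site 2)) (hi + (j : Site 2)) x).1 (ctDir G ψ w₀ R (lo - (j : Site 2)) (hi + (j : Site 2)) x).2).le_lin_of_le_sdepth (φ := φ) (v := ctT1 G ψ P w₀ R (lo - (j : Site 2)) (hi + (j : Site 2)) x)
        (m := 1 + P.d) (by rw [ht.1])
      unfold ctApron
      exact card_apronFin_le hΔ (hK _ _ _ hzge)
  have hfaceC : ∀ x : V, (ctFace G SF Rg P w₀ R x).card ≤ cU := fun x =>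
    le_trans (Finset.card_le_card ((ctFace_subset_ctQk SF Rg x).trans (ctQk_subset_Rg SF Rg x))) (hRgcard _)
  have hhost : ∀ x ∈ (outerBoundary (winGraph G w₀ R) (winLevel G ψ w₀ R lo hi j)), (hosts G SF P w₀ R (outerBoundary (winGraph G w₀ R) (winLevel G ψ w₀ R lo hi j)) x).Nonempty →
      host G SF P w₀ R (outerBoundary (winGraph G w₀ R) (winLevel G ψ w₀ R lo hi j)) x ∈ (outerBoundary (winGraph G w₀ R) (winLevel G ψ w₀ R lo hi j)) ∧ IsNear G ψ (lo - (j : Site 2)) (hi + (j : Site 2)) P w₀ R (host G SF P w₀ R (outerBoundary (winGraph G w₀ R) (winLevel G ψ w₀ R lo hi j)) x) ∧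
        ctY G ψ w₀ R (lo - (j : Site 2)) (hi + (j : Site 2)) x ∈ ctReg G SF P w₀ R (host G SF P w₀ R (outerBoundary (winGraph G w₀ R) (winLevel G ψ w₀ R lo hi j)) x) :=
    fun x _ h => mem_hosts.1 (host_mem h)
  have habsB : ∀ x ∈ (outerBoundary (winGraph G w₀ R) (winLevel G ψ w₀ R lo hi j)), (hosts G SF P w₀ R (outerBoundary (winGraph G w₀ R) (winLevel G ψ w₀ R lo hi j)) x).Nonempty →
      ∀ v ∈ graphBall G (ctY G ψ w₀ R (lo - (j : Site 2)) (hi + (j : Site 2)) (host G SF P w₀ R (outerBoundary (winGraph G w₀ R) (winLevel G ψ w₀ R lo hi j)) x)) r₁, v ∈ graphBall G x rs := by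
    intro x hx h v hv
    obtain ⟨h0K, -, hyin⟩ := hhost x hx h
    have h1 := hregB _ h0K _ hyin   -- y ∈ B(y₀, r₁)
    have h2 := BoxProdZ2.mem_graphBall_add G ((BoxProdZ2.mem_graphBall_comm G).1 h1) hv  -- v ∈ B(y, r₁ + r₁)
    exact graphBall_mono G x (by omega) (BoxProdZ2.mem_graphBall_add G (hy1 x hx) h2)
  refine ⟨fun x hx => ?_, fun x hx => ?_, fun x hx => ?_, fun x hx => ?_, fun x hx => ?_, fun x hx => ?_, fun x hx => ?_, fun x hx => ?_,
    fun x hx => ?_, fun x hx => ?_⟩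
  · -- adj
    exact (hy x hx).1
  · -- y_mem
    show ctY G ψ w₀ R (lo - (j : Site 2)) (hi + (j : Site 2)) x ∈ (apronGeomA G SF Rg P w₀ R (outerBoundary (winGraph G w₀ R) (winLevel G ψ w₀ R lo hi j))).S x
    simp only [apronGeomA]
    split_ifs with hnear habs
    · exact hyreg x hx
    · exact (hhost x hx habs).2.2
    · exact Finset.mem_singleton_self _
  · -- S_sub
    intro v hv
    simp only [apronGeomA] at hv
    split_ifs at hv with hnear habs
    · exact hregW x hx hnear hv
    · exact hregW _ (hhost x hx habs).1 (hhost x hx habs).2.1 hv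
    · rw [Finset.mem_singleton] at hv; rw [hv]; exact hyW x hx
  · -- U_sub
    intro u hu
    simp only [apronGeomA] at hu
    split_ifs at hu with hnear habs
    · exact hfaceW x hx hu
    · exact hfaceW _ (hhost x hx habs).1 hu
    · rw [Finset.mem_singleton] at hu; rw [hu]; exact hyW x hx
  · -- S_ball
    intro v hv
    simp only [apronGeomA] at hv
    split_ifs at hv with hnear habs
    · exact graphBall_mono G x (by omega) (BoxProdZ2.mem_graphBall_add G (hy1 x hx) (hregB x hx v hv))
    · exact habsB x hx habs v (hregB _ (hhost x hx habs).1 v hv)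
    · rw [Finset.mem_singleton] at hv; rw [hv]; exact graphBall_mono G x (by omega) (hy1 x hx)
  · -- U_ball
    intro u hu
    simp only [apronGeomA] at hu
    split_ifs at hu with hnear habs
    · exact graphBall_mono G x (by omega) (BoxProdZ2.mem_graphBall_add G (hy1 x hx) (hfaceB x hx u hu))
    · exact habsB x hx habs u (hfaceB _ (hhost x hx habs).1 u hu)
    · rw [Finset.mem_singleton] at hu; rw [hu]; exact graphBall_mono G x (by omega) (hy1 x hx)
  · -- S_path
    intro v hv
    show PathIn G (↑((apronGeomA G SF Rg P w₀ R (outerBoundary (winGraph G w₀ R) (winLevel G ψ w₀ R lo hi j))).S x) : Set V) (ctY G ψ w₀ R (lo - (j : Site 2)) (hi + (j : Site 2)) x) v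
    simp only [apronGeomA] at hv ⊢
    split_ifs at hv ⊢ with hnear habs
    · exact hregP x hx v hv
    · obtain ⟨h0K, -, hyin⟩ := hhost x hx habs
      exact (hregP _ h0K _ hyin).symm.trans (hregP _ h0K v hv)
    · rw [Finset.mem_singleton] at hv; subst hv
      exact PathIn.refl (by simp)
  · -- U_adj
    intro u hu
    simp only [apronGeomA] at hu ⊢
    split_ifs at hu ⊢ with hnear habs
    · obtain ⟨w, hw, hadj⟩ := exists_adj_of_mem_ctFace SF Rg hu
      exact Or.inr ⟨w, by unfold ctReg; exact Finset.mem_union_right _ hw, hadj⟩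
    · obtain ⟨w, hw, hadj⟩ := exists_adj_of_mem_ctFace SF Rg hu
      exact Or.inr ⟨w, by unfold ctReg; exact Finset.mem_union_right _ hw, hadj⟩
    · exact Or.inl hu
  · -- S_card
    simp only [apronGeomA]
    split_ifs with hnear habs
    · exact hregC x hx
    · exact hregC _ (hhost x hx habs).1
    · rw [Finset.card_singleton]; exact h1cS
  · -- U_card
    simp only [apronGeomA]
    split_ifs with hnear habs
    · exact hfaceC x
    · exact hfaceC _
    · rw [Finset.card_singleton]; exact hcU1

end OK

end Skelφ

end Summit.CriticalPhenomena.PercolationContinuityZ3.Theorems.Transplant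
end
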